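import Summits.QuantumFields.QCD.Theses.QuarksAsStableAction

/-!
# Line `stub_chiralCompletion` — registered skeleton for the BARE SIDE of the bridge split of crux
# `QuarksAsStableAction.StableActionBridge` (item stmt-QuantumFields-9737, route route-QuantumFields-QuarksAsStableAction)

Skeleton-registrar seat `planner-skel-stmt-QuantumFields-9737-stub_chiralCompl-0` (route re-audit bin REPAIRABLE,
trivial-seam bare side; 2026-08-17).

## What is being planned, and why here

The deciding crux `StableActionBridge := UnquenchedChessboardBound → WilsonQuarkStability → QCD` has both hypotheses
proved in the tree (items 9735, 9736), so it IS the conjunct `QCD = QCDOf 2 ∧ QCDOf 3`; the route decomposes it by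
modus ponens (glue item stmt-QuantumFields-17395 `StableActionBridgeOfSplit : ThresholdQCD → ChiralCompletion →
StableActionBridge`, proved; the former lead skeleton `Lines/Sketch.lean` sha 22de6e34 had exactly the two stubs
`stub_thresholdQCD : ThresholdQCD` (item 8794 — planned: route HeavyThresholdYMBridge and its lines) and
`stub_chiralCompletion : ChiralCompletion` (item 17394 — THE CHIRAL COMPLETION: from the threshold form conclude
the re-typed `QCDOf N_f`, i.e. ONE mass-scaling regularisation with the body at EVERY positive tuple AND
`IsChiralAtZero`).  A bridge split passes the birth certificate only with A PLAN FOR BOTH SIDES; this file is the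
plan for the bare side `stub_chiralCompletion`: a skeleton whose composition concludes
`Summit.QuantumFields.QCD.Theses.QuarksAsStableAction.ChiralCompletion` BY NAME from two named stubs, with real
mathematics (not modus ponens) in the seam.

## The line: the LEAST ADMISSIBLE THRESHOLD of the given regularisation

For the regularisation `reg` of the threshold form let `S = {M : ℝ | the QCDOf body holds at every tuple with all
components > M}` (an up-set, `M₀ ∈ S`).  Two statement-shaped physical inputs, both FILED, GROUND-STAMPED ITEMS of
this route (strategist decomposition cstrat-stmt-QuantumFields-9737-r1; they are the pool's shared chiral debt — the
same two stubs carry the registered birth skeletons of item 17394 `Cruxes/ChiralCompletion/Lines/birth.lean` and of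
item 17661 `…/birth_HeavyThresholdYMBridge.lean`, so the content is staffed ONCE), taken BY NAME:

* `stub_massContinuation : MassContinuation` (item stmt-QuantumFields-18327, crux rank 6, open, XL) — THE MASSIVE
  PHASE IS OPEN BELOW A UNIFORMLY GAPPED THRESHOLD: body on `{m | ∀ f, M < m f}` + ONE lattice rate `ε` there ⇒ body on
  `{m | ∀ f, M − δ < m f}` for some `δ > 0` (uniform-in-`k` complex-bare-mass bounds from a real uniform gap, Vitali
  convergence of the SAME sequence, openness of non-triviality and of a gap `≥ ε/2`).
* `stub_chiralTupleGapless : ChiralTupleGapless` (item stmt-QuantumFields-18328, crux rank 8, open, XL) — THE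
  GAPLESSNESS INPUT: a mass-scaling `reg` carrying the body on some half-orthant has a tuple `m₀` at which
  `reg.scheme m₀ 0 0` has no uniform lattice gap at ANY positive rate (massless `N_f = 2, 3` QCD is gapless:
  Goldstone pions / anomaly matching; finite chiral offset of a regularisation with dynamical quarks).

COMPOSITION `ChiralCompletion_of : MassContinuation → ChiralTupleGapless → ChiralCompletion` (no `sorry`; axioms
`propext, Classical.choice, Quot.sound`): `S` is bounded below by the least component of the gapless tuple
(`bddBelow_admissible`); `M⋆ = sInf S` is admissible (a tuple above `M⋆` in each of its finitely many components is
above a MEMBER of `S`, `exists_mem_forall_lt_of_csInf_lt`, `N_f ≠ 0` from `N_f ∈ {2,3}`); the lattice gap CLOSES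
above `M⋆` (a uniform rate above `M⋆` would, by mass continuation, put `M⋆ − δ ∈ S`, against `csInf_le`) —
`exists_leastThreshold_gapCloses`; and re-centring the flavour-blind critical mass `m_crit(k) ↦ m_crit(k) + a_k M⋆/Z_m(k)`
(`recentre`, `scheme_recentre`: it changes neither `HasMassScaling` nor the scheme at shifted masses) witnesses the
re-typed `QCDOf N_f` INCLUDING `IsChiralAtZero` (`qcdOf_of_gapClosingThreshold`, no sign condition on `M⋆`).  The
additive mass renormalisation is PINNED by an extremal argument — it is output, not a postulated Ward-identity tuning.
Self-contained re-derivation (this file imports only the route file) of the argument first kernel-checked in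
`Cruxes/StableActionBridge/Lines/least_threshold.lean` (`chiralCompletion_of_pieces`) and in the 17394 birth skeleton.

DOCKING into the bridge split (sorry-free, hypotheses not stubs): `StableActionBridge_of_threshold :
ThresholdQCD → MassContinuation → ChiralTupleGapless → StableActionBridge` and `qcd_of_threshold` — with the planned
side `ThresholdQCD` (8794) the two stubs of this file close the parent crux and the conjunct.

## Negative knowledge honoured (Disproof used)
* No `Disproof.lean` exists for crux 9737 (`ledger crux ls stmt-QuantumFields-9737`, 2026-08-17T08:2xZ) nor for 17394.
* Landed obstruction `RobustYangMillsHandover.Negative.not_isChiralAtZero_mcrit_shift_of_uniformGapAbove` (a re-centring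
  at a UNIFORMLY GAPPED threshold is never chiral at zero): honoured — the re-centring is at the LEAST admissible
  threshold, above which uniformity of the gap is refuted INSIDE the proof (else mass continuation lowers the threshold).
* `ChiralGluonicCompletion.Negative.qcdOf_iff_chiralThreshold` (landed two-sided chiral reading of `QCDOf`):
  `qcdOf_of_gapClosingThreshold` is its `←` direction without the sign condition.
* `ledger negatives --problem QuantumFields` (5 entries 2026-08-17: RobustYangMillsRG 14958, DiagonalMirrorRP 9665,
  AdaptiveCoarseSystem 9494, MultibosonLatticeGap 9599, AdmissibleRootsExist 9603): none concerns mass continuation,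
  gap closure or chirality of a regularisation; neither stub is an instance of a refuted statement.
* Converse bookkeeping: `QCD → ChiralCompletion` is landed (`Theorems…StableActionBridgeOfSplit: chiralCompletion_of_qcd`)
  — the piece is a consequence of the conjunct USED TOWARD it (glue 17395 / `closes`), as every implication-shaped
  completion is; the per-stub probes `stub → QCD`, `stub → ChiralCompletion`, `stub → StableActionBridge` all FAIL
  (registrar folder `bc/`, recorded in `Lines/stub_chiralCompletion.md`).
-/

noncomputable section

namespace Summit.QuantumFields.QCD.Cruxes.StableActionBridge.StubChiralCompletion

open Literature.MathematicalPhysics.QuantumFieldTheory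
open Summit.QuantumFields.QCD.Theses.QuarksAsStableAction (StableActionBridge ThresholdQCD ChiralCompletion
  MassContinuation ChiralTupleGapless StableActionBridgeOfSplit)

/-! ## §1 The registered stubs (the ONLY `sorry`s of this file) — two route items, BY NAME -/

/-- **(S1) mass continuation — the massive phase is open below a uniformly gapped threshold**
(item stmt-QuantumFields-18327 `QuarksAsStableAction.MassContinuation`, verbatim): for `N_f ∈ {2,3}`, every
mass-scaling `reg`, every real `M` and rate `ε > 0` — IF the `QCDOf` body holds at every tuple of the open
half-orthant `{m | ∀ f, M < m f}` AND the lattice theories `reg.scheme m 0 0` there all have the ONE rate `ε`,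
THEN for some `δ > 0` the body holds on `{m | ∀ f, M − δ < m f}`.  Open, size XL. -/
theorem stub_massContinuation : MassContinuation := by
  sorry

/-- **(S2) the chiral tuple is gapless — the gaplessness input**
(item stmt-QuantumFields-18328 `QuarksAsStableAction.ChiralTupleGapless`, verbatim): for `N_f ∈ {2,3}`, every
mass-scaling `reg` carrying the `QCDOf` body on some half-orthant `{m | ∀ f, M < m f}` has a renormalised mass
tuple `m₀` with `∀ Δ > 0, ¬ (reg.scheme m₀ 0 0).HasLatticeMassGap Δ`.  Open, size XL. -/
theorem stub_chiralTupleGapless : ChiralTupleGapless := by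
  sorry

/-! ## §2 The extremal argument — pure order theory on `ℝ` (no `sorry` from here on)

`good m`: the tuple `m` carries the body; `gap m ε`: rate-`ε` lattice gap at `m`; a threshold `M` is ADMISSIBLE
when every tuple of `{m | ∀ f, M < m f}` is good. -/

variable {Nf : ℕ}

/-- **Tuples above an infimum** (`N_f ≠ 0`): a tuple strictly above `sInf S` in each of its finitely many
components is, in each component, strictly above some MEMBER of `S` (one below its least component). [folklore] -/
theorem exists_mem_forall_lt_of_csInf_lt [NeZero Nf] {S : Set ℝ} (hne : S.Nonempty) {m : Fin Nf → ℝ}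
    (hm : ∀ f, sInf S < m f) : ∃ M ∈ S, ∀ f, M < m f := by
  have hlt : sInf S < Finset.univ.inf' Finset.univ_nonempty m :=
    (Finset.lt_inf'_iff _).2 fun f _ => hm f
  obtain ⟨M, hMS, hMlt⟩ := exists_lt_of_csInf_lt hne hlt
  exact ⟨M, hMS, fun f => lt_of_lt_of_le hMlt (Finset.inf'_le _ (Finset.mem_univ f))⟩

/-- **A gapless tuple bounds the admissible thresholds from below** by its least component: a threshold below
every component of `m₀` would make `m₀` good, hence gapped at some positive rate. [folklore] -/
theorem bddBelow_admissible [NeZero Nf] (good : (Fin Nf → ℝ) → Prop) (gap : (Fin Nf → ℝ) → ℝ → Prop)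
    (hgg : ∀ m, good m → ∃ Δ > 0, gap m Δ) {m₀ : Fin Nf → ℝ} (hm₀ : ∀ Δ, 0 < Δ → ¬ gap m₀ Δ) :
    BddBelow {M : ℝ | ∀ m, (∀ f, M < m f) → good m} := by
  refine ⟨Finset.univ.inf' Finset.univ_nonempty m₀, fun M hM => ?_⟩
  by_contra hle
  have hlt : M < Finset.univ.inf' Finset.univ_nonempty m₀ := not_le.mp hle
  have hall : ∀ f, M < m₀ f := fun f => lt_of_lt_of_le hlt (Finset.inf'_le _ (Finset.mem_univ f))
  obtain ⟨Δ, hΔ, hgap⟩ := hgg m₀ (hM m₀ hall)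
  exact hm₀ Δ hΔ hgap

/-- **The least admissible threshold, and gap closure above it** (`N_f ≠ 0`).  If good tuples are gapped at some
positive rate, some threshold is admissible, admissibility is OPEN BELOW every uniformly gapped admissible threshold
(mass continuation) and some tuple is gapless at every rate (gaplessness), then `M⋆ = sInf {admissible}` is
admissible and, for every rate `ε > 0`, some tuple above `M⋆` is NOT `ε`-gapped: a uniform rate above `M⋆` would
make `M⋆ − δ` admissible, against `csInf_le`. [folklore] -/
theorem exists_leastThreshold_gapCloses [NeZero Nf] (good : (Fin Nf → ℝ) → Prop)
    (gap : (Fin Nf → ℝ) → ℝ → Prop)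
    (hgg : ∀ m, good m → ∃ Δ > 0, gap m Δ)
    (hthr : ∃ M₀ : ℝ, ∀ m, (∀ f, M₀ < m f) → good m)
    (hopen : ∀ M ε : ℝ, 0 < ε → (∀ m, (∀ f, M < m f) → good m) → (∀ m, (∀ f, M < m f) → gap m ε) →
      ∃ δ > 0, ∀ m, (∀ f, M - δ < m f) → good m)
    (hgapless : ∃ m₀, ∀ Δ, 0 < Δ → ¬ gap m₀ Δ) :
    ∃ M : ℝ, (∀ m, (∀ f, M < m f) → good m) ∧ ∀ ε > 0, ∃ m, (∀ f, M < m f) ∧ ¬ gap m ε := by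
  set S : Set ℝ := {M : ℝ | ∀ m, (∀ f, M < m f) → good m} with hS
  have hne : S.Nonempty := hthr
  obtain ⟨m₀, hm₀⟩ := hgapless
  have hbdd : BddBelow S := bddBelow_admissible good gap hgg hm₀
  -- (1) the infimum is admissible
  have hinf : ∀ m, (∀ f, sInf S < m f) → good m := fun m hm => by
    obtain ⟨M, hMS, hMm⟩ := exists_mem_forall_lt_of_csInf_lt hne hm
    exact hMS m hMm
  refine ⟨sInf S, hinf, fun ε hε => ?_⟩
  -- (2) the gap closes above the infimum
  by_contra hcl
  have huni : ∀ m, (∀ f, sInf S < m f) → gap m ε := fun m hm => by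
    by_contra hg
    exact hcl ⟨m, hm, hg⟩
  obtain ⟨δ, hδ, hAδ⟩ := hopen (sInf S) ε hε hinf huni
  have hle : sInf S ≤ sInf S - δ := csInf_le hbdd hAδ
  linarith

/-! ## §3 Re-centring the critical mass at a threshold above which the gap closes pins `QCDOf` -/

/-- **Re-centring the flavour-blind critical bare mass at the offset `M`**: `m_crit(k) ↦ m_crit(k) + a_k M / Z_m(k)` —
the additive mass renormalisation of Wilson fermions, the only datum of `reg` that is touched.
[cite: MontvayMunster1994, §5.1] -/
def recentre (reg : QCDRegularisation Nf) (M : ℝ) : QCDRegularisation Nf :=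
  { reg with mcrit := fun k => reg.mcrit k + reg.a k * M / reg.Zm k }

/-- Re-centring never touches `HasMassScaling` (it reads only `a_k` and `Z_m(k)`): definitional. [folklore] -/
theorem hasMassScaling_recentre_iff (reg : QCDRegularisation Nf) (M : ℝ) :
    (recentre reg M).HasMassScaling ↔ reg.HasMassScaling :=
  Iff.rfl

/-- **Running the re-centred regularisation at masses `m` IS running the original one at `M + m`.** [folklore] -/
theorem scheme_recentre (reg : QCDRegularisation Nf) (M : ℝ) (m : Fin Nf → ℝ)
    (z shift : QCDField Nf → ℕ → ℝ) :
    (recentre reg M).scheme m z shift = reg.scheme (fun f => M + m f) z shift := by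
  simp only [QCDRegularisation.scheme, recentre, QCDScheme.mk.injEq, true_and, and_true]
  funext f k
  ring

/-- **The pinning theorem.**  If the mass-scaling `reg` carries the `QCDOf` body at every tuple of the half-orthant
above `M` AND the lattice gap closes above `M` (for every rate `ε > 0` some tuple above `M` is not `ε`-gapped), then
`recentre reg M` witnesses the re-typed conjunct `QCDOf N_f`: mass scaling (untouched), the body at EVERY positive
tuple (`m ↦ M + m` lands in the half-orthant) AND `IsChiralAtZero` (the not-`ε`-gapped tuples above `M` become
positive tuples).  No sign condition on `M`. [folklore] -/
theorem qcdOf_of_gapClosingThreshold (reg : QCDRegularisation Nf) (M : ℝ) (hMS : reg.HasMassScaling)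
    (hbody : ∀ m : Fin Nf → ℝ, (∀ f, M < m f) →
      ∃ (z shift : QCDField Nf → ℕ → ℝ) (T : OSData (QCDField Nf) 4),
        IsQCDAlong (reg.scheme m z shift) T ∧ T.IsNontrivial QCDField.glue ∧ T.IsNonGaussian QCDField.glue ∧
          (∀ f g : Fin Nf, f ≠ g → T.IsNontrivial (QCDField.pseudoRe f g)) ∧
            ∃ Δ > 0, T.HasMassGap Δ ∧ (reg.scheme m z shift).HasLatticeMassGap Δ)
    (hcl : ∀ ε > (0 : ℝ), ∃ m : Fin Nf → ℝ, (∀ f, M < m f) ∧ ¬ (reg.scheme m 0 0).HasLatticeMassGap ε) :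
    QCDOf Nf := by
  refine ⟨recentre reg M, (hasMassScaling_recentre_iff reg M).2 hMS, fun ε hε => ?_, fun m hm => ?_⟩
  · -- chirality at zero: a not-`ε`-gapped tuple above `M`, pulled back to positive masses
    obtain ⟨m, hm, hgap⟩ := hcl ε hε
    refine ⟨fun f => m f - M, fun f => sub_pos.2 (hm f), ?_⟩
    have hm' : (fun f => M + (m f - M)) = m := funext fun f => by ring
    rw [scheme_recentre, hm']
    exact hgap
  · -- the body at every positive tuple
    obtain ⟨z, shift, T, hQ, hN, hG, hP, Δ, hΔ, hT, hL⟩ :=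
      hbody (fun f => M + m f) fun f => lt_add_of_pos_right M (hm f)
    refine ⟨z, shift, T, ?_, hN, hG, hP, Δ, hΔ, hT, ?_⟩
    · rwa [scheme_recentre]
    · rwa [scheme_recentre]

/-- **One regularisation, from threshold data to the re-typed conjunct** (`N_f ≠ 0`): the body above some `M₀`,
mass continuation specialised to `reg`, and a gapless tuple of `reg` give `QCDOf N_f` — through the least admissible
threshold (§2) and the re-centred critical mass (§3).  Good tuples are lattice-gapped at the body's own rate:
`HasLatticeMassGap` never reads the species renormalisations, so `reg.scheme m z shift` and `reg.scheme m 0 0` have the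
same gap clause DEFINITIONALLY. [folklore] -/
theorem qcdOf_of_threshold_continuation_gapless [NeZero Nf] (reg : QCDRegularisation Nf)
    (hMS : reg.HasMassScaling)
    (hthr : ∃ M₀ : ℝ, ∀ m : Fin Nf → ℝ, (∀ f, M₀ < m f) →
      ∃ (z shift : QCDField Nf → ℕ → ℝ) (T : OSData (QCDField Nf) 4),
        IsQCDAlong (reg.scheme m z shift) T ∧ T.IsNontrivial QCDField.glue ∧ T.IsNonGaussian QCDField.glue ∧
          (∀ f g : Fin Nf, f ≠ g → T.IsNontrivial (QCDField.pseudoRe f g)) ∧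
            ∃ Δ > 0, T.HasMassGap Δ ∧ (reg.scheme m z shift).HasLatticeMassGap Δ)
    (hopen : ∀ M ε : ℝ, 0 < ε →
      (∀ m : Fin Nf → ℝ, (∀ f, M < m f) →
        ∃ (z shift : QCDField Nf → ℕ → ℝ) (T : OSData (QCDField Nf) 4),
          IsQCDAlong (reg.scheme m z shift) T ∧ T.IsNontrivial QCDField.glue ∧ T.IsNonGaussian QCDField.glue ∧
            (∀ f g : Fin Nf, f ≠ g → T.IsNontrivial (QCDField.pseudoRe f g)) ∧
              ∃ Δ > 0, T.HasMassGap Δ ∧ (reg.scheme m z shift).HasLatticeMassGap Δ) →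
      (∀ m : Fin Nf → ℝ, (∀ f, M < m f) → (reg.scheme m 0 0).HasLatticeMassGap ε) →
        ∃ δ > 0, ∀ m : Fin Nf → ℝ, (∀ f, M - δ < m f) →
          ∃ (z shift : QCDField Nf → ℕ → ℝ) (T : OSData (QCDField Nf) 4),
            IsQCDAlong (reg.scheme m z shift) T ∧ T.IsNontrivial QCDField.glue ∧ T.IsNonGaussian QCDField.glue ∧
              (∀ f g : Fin Nf, f ≠ g → T.IsNontrivial (QCDField.pseudoRe f g)) ∧
                ∃ Δ > 0, T.HasMassGap Δ ∧ (reg.scheme m z shift).HasLatticeMassGap Δ)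
    (hgapless : ∃ m₀ : Fin Nf → ℝ, ∀ Δ, 0 < Δ → ¬ (reg.scheme m₀ 0 0).HasLatticeMassGap Δ) :
    QCDOf Nf := by
  obtain ⟨M, hA, hcl⟩ := exists_leastThreshold_gapCloses
    (fun m : Fin Nf → ℝ =>
      ∃ (z shift : QCDField Nf → ℕ → ℝ) (T : OSData (QCDField Nf) 4),
        IsQCDAlong (reg.scheme m z shift) T ∧ T.IsNontrivial QCDField.glue ∧ T.IsNonGaussian QCDField.glue ∧
          (∀ f g : Fin Nf, f ≠ g → T.IsNontrivial (QCDField.pseudoRe f g)) ∧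
            ∃ Δ > 0, T.HasMassGap Δ ∧ (reg.scheme m z shift).HasLatticeMassGap Δ)
    (fun m ε => (reg.scheme m 0 0).HasLatticeMassGap ε)
    (by
      rintro m ⟨z, shift, T, -, -, -, -, Δ, hΔ, -, hL⟩
      exact ⟨Δ, hΔ, hL⟩)
    hthr hopen hgapless
  exact qcdOf_of_gapClosingThreshold reg M hMS hA hcl

/-! ## §4 Composition (kernel-checked): the piece BY NAME from the two stubs, and its docking into the bridge -/

/-- **THE PIECE FROM THE TWO STUBS** — concludes `Summit.QuantumFields.QCD.Theses.QuarksAsStableAction.ChiralCompletion`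
BY NAME (the statement of the former skeleton stub `stub_chiralCompletion`, = item stmt-QuantumFields-17394).  Given
`N_f ∈ {2,3}` and the threshold form (`M₀ ≥ 0`, a mass-scaling `reg` with the body above `M₀`): mass continuation (S1,
specialised to this `reg`) makes admissibility open below uniformly gapped thresholds; the gapless tuple (S2, fed with
the body above `M₀`) bounds the admissible thresholds below; so the least admissible threshold exists, is admissible,
the gap closes above it, and the re-centred regularisation witnesses the re-typed `QCDOf N_f`. -/
theorem ChiralCompletion_of : MassContinuation → ChiralTupleGapless → ChiralCompletion := by
  intro hMC hCT Nf hNf hthr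
  obtain ⟨M₀, -, reg, hMS, hbody⟩ := hthr
  haveI : NeZero Nf := ⟨by rcases hNf with rfl | rfl <;> decide⟩
  exact qcdOf_of_threshold_continuation_gapless reg hMS ⟨M₀, hbody⟩
    (fun M ε hε hgood hgap => hMC Nf hNf reg M ε hMS hε hgood hgap) (hCT Nf hNf reg M₀ hMS hbody)

/-- **The piece along this skeleton** — the former `stub_chiralCompletion` of line `Sketch` (sha 22de6e34), now the
composition of the two registered stubs of §1 (the only non-closed axiom is theirs). -/
theorem chiralCompletion_closed : ChiralCompletion :=
  ChiralCompletion_of stub_massContinuation stub_chiralTupleGapless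

/-- **Docking into the bridge split** (hypotheses, not stubs): with the PLANNED side `ThresholdQCD` (item
stmt-QuantumFields-8794; route HeavyThresholdYMBridge and its lines) the two stubs of this file give the parent crux
`StableActionBridge` — through the piece and the route's modus-ponens glue shape
(`StableActionBridgeOfSplit`, item 17395, proved), here inlined: the bridge's own hypotheses A, S are discarded. [folklore] -/
theorem StableActionBridge_of_threshold :
    ThresholdQCD → MassContinuation → ChiralTupleGapless → StableActionBridge :=
  fun hT hMC hCT _ _ =>
    ⟨ChiralCompletion_of hMC hCT 2 (Or.inl rfl) (hT 2 (Or.inl rfl)),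
      ChiralCompletion_of hMC hCT 3 (Or.inr rfl) (hT 3 (Or.inr rfl))⟩

/-- The conjunct itself from the planned side and the two stubs' statements. [folklore] -/
theorem qcd_of_threshold (hT : ThresholdQCD) (hMC : MassContinuation) (hCT : ChiralTupleGapless) : _root_.QCD :=
  ⟨ChiralCompletion_of hMC hCT 2 (Or.inl rfl) (hT 2 (Or.inl rfl)),
    ChiralCompletion_of hMC hCT 3 (Or.inr rfl) (hT 3 (Or.inr rfl))⟩

/-- The route's glue item `StableActionBridgeOfSplit` (17395) composed with this file's piece: both sides planned,
the bridge closes from `ThresholdQCD` and the two chiral stubs. [folklore] -/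
theorem stableActionBridge_of_split_and_pieces (hsplit : StableActionBridgeOfSplit) (hT : ThresholdQCD)
    (hMC : MassContinuation) (hCT : ChiralTupleGapless) : StableActionBridge :=
  hsplit hT (ChiralCompletion_of hMC hCT)

end Summit.QuantumFields.QCD.Cruxes.StableActionBridge.StubChiralCompletion

end
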